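import Mathlib
import HarnessLib

/-!
# `GrenetZeon.DualUnipotentThreeHalves` (stmt-ValiantsHypothesis-24318), R2 `HeavyTopLaw` — instrument kernel row
# «§8 enumerator soundness», LAYER 1: a COMPOSITION CHAIN of invariant subspaces for any set of matrices

For ANY set `S` of `m × m` complex matrices acting on `ℂ^m` by `Matrix.mulVec` there is a descending chain of
`S`-invariant subspaces `ℂ^m = F 0 > F 1 > ⋯ > F L = 0` whose steps are IRREDUCIBLE: no `S`-invariant subspace lies
strictly between `F (t+1)` and `F t` (`exists_composition_chain`).  The chain is produced by repeatedly taking an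
invariant subspace of MINIMAL CODIMENSION strictly inside the current one (`exists_maximal_invariant_lt`, `Nat.find` on
the codimension; induction on `finrank`).  The convention (descending, `ℕ`-indexed, `Antitone`, `F 0 = ⊤`, `F L = ⊥`) is
the one of the tree's adapted-basis glue ✓ `GrenetZeon.RadicalCoarsening.exists_adapted_basis`, which turns the chain
into a constant change of basis `P` and a level function for ✓ `GrenetZeon.HeavyTopInvariantFlag.flagCheap_of_block_levels`
(layer 2, `…HeavyTopCompositionBound.lean`): this is the composition-series step of `INSTANCES.md` v2.2a §7 (val-port-3 g2)
behind the enumerator `port3g2-composition-loci.py` (desk RULING #299 (a); critic of record val-idea-crit-3 g4).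

Honest framing: elementary linear algebra (a Jordan–Hölder-type chain for a set of operators); a helper toward the
INSTANCE rows of the LAW R2 — nothing here proves or refutes `HeavyTopLaw`, 24318, S3b or any instance `HeavyTopInst n m`;
`VP ≠ VNP` is NOT proved; no summit statement is proved here.  No definitions, no named facts.  [folklore]
-/

noncomputable section

-- single-conjunct layout: Sub = Summit, duplicated namespace component intended
set_option linter.dupNamespace false

namespace Summit.ValiantsHypothesis.ValiantsHypothesis.Theorems.GrenetZeon.HeavyTopCompositionBound

open Matrix
open scoped BigOperators

variable {m : ℕ}

/-- The zero subspace is invariant under every matrix. [folklore] -/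
theorem bot_invariant (S : Set (Matrix (Fin m) (Fin m) ℂ)) :
    ∀ A ∈ S, ∀ x ∈ (⊥ : Submodule ℂ (Fin m → ℂ)), A *ᵥ x ∈ (⊥ : Submodule ℂ (Fin m → ℂ)) := by
  intro A _ x hx
  rw [(Submodule.mem_bot ℂ).1 hx, Matrix.mulVec_zero]
  exact Submodule.zero_mem _

/-- **A maximal invariant subspace strictly below a non-zero subspace.**  For any set `S` of matrices and any
subspace `U ≠ 0` there is an `S`-invariant `U' < U` such that no `S`-invariant subspace lies strictly between `U'`
and `U` (take an invariant `U' < U` of minimal codimension in `U`; `U' = 0` is a candidate). [folklore] -/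
theorem exists_maximal_invariant_lt (S : Set (Matrix (Fin m) (Fin m) ℂ)) (U : Submodule ℂ (Fin m → ℂ))
    (hne : U ≠ ⊥) :
    ∃ U' : Submodule ℂ (Fin m → ℂ), U' < U ∧ (∀ A ∈ S, ∀ x ∈ U', A *ᵥ x ∈ U') ∧
      ∀ X : Submodule ℂ (Fin m → ℂ), (∀ A ∈ S, ∀ x ∈ X, A *ᵥ x ∈ X) → U' ≤ X → X ≤ U → X = U' ∨ X = U := by
  classical
  have hex : ∃ k : ℕ, ∃ U' : Submodule ℂ (Fin m → ℂ), U' < U ∧ (∀ A ∈ S, ∀ x ∈ U', A *ᵥ x ∈ U') ∧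
      Module.finrank ℂ U' + k = Module.finrank ℂ U :=
    ⟨Module.finrank ℂ U, ⊥, bot_lt_iff_ne_bot.2 hne, bot_invariant S, by simp⟩
  obtain ⟨U', hlt, hinv, hk⟩ := Nat.find_spec hex
  refine ⟨U', hlt, hinv, fun X hX h1 h2 => ?_⟩
  rcases eq_or_lt_of_le h2 with h | h
  · exact Or.inr h
  · left
    have hXk : Module.finrank ℂ X + (Module.finrank ℂ U - Module.finrank ℂ X) = Module.finrank ℂ U := by
      have := Submodule.finrank_mono h.le
      omega
    have hmin : Nat.find hex ≤ Module.finrank ℂ U - Module.finrank ℂ X := Nat.find_min' hex ⟨X, h, hX, hXk⟩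
    have hle : Module.finrank ℂ X ≤ Module.finrank ℂ U' := by
      have := Submodule.finrank_mono h.le
      omega
    exact (Submodule.eq_of_le_of_finrank_le h1 hle).symm

/-- **Composition chain below an invariant subspace** (induction on the dimension): a descending chain of
`S`-invariant subspaces from `U` to `0` with irreducible steps. [folklore] -/
theorem exists_composition_chain_from (S : Set (Matrix (Fin m) (Fin m) ℂ)) :
    ∀ (d : ℕ) (U : Submodule ℂ (Fin m → ℂ)), Module.finrank ℂ U = d → (∀ A ∈ S, ∀ x ∈ U, A *ᵥ x ∈ U) →
      ∃ (L : ℕ) (F : ℕ → Submodule ℂ (Fin m → ℂ)), F 0 = U ∧ F L = ⊥ ∧ Antitone F ∧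
        (∀ t, t < L → F (t + 1) < F t) ∧ (∀ t, ∀ A ∈ S, ∀ x ∈ F t, A *ᵥ x ∈ F t) ∧
        (∀ t, t < L → ∀ X : Submodule ℂ (Fin m → ℂ), (∀ A ∈ S, ∀ x ∈ X, A *ᵥ x ∈ X) →
          F (t + 1) ≤ X → X ≤ F t → X = F (t + 1) ∨ X = F t) := by
  intro d
  induction d using Nat.strong_induction_on with
  | _ d ih =>
    intro U hd hU
    by_cases hbot : U = ⊥
    · refine ⟨0, fun _ => ⊥, hbot.symm, rfl, fun _ _ _ => le_rfl, fun t ht => absurd ht (Nat.not_lt_zero t),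
        fun _ => bot_invariant S, fun t ht => absurd ht (Nat.not_lt_zero t)⟩
    · obtain ⟨U', hlt, hinv', hcov⟩ := exists_maximal_invariant_lt S U hbot
      have hd' : Module.finrank ℂ U' < d := hd ▸ Submodule.finrank_lt_finrank_of_lt hlt
      obtain ⟨L, F, hF0, hFL, hanti, hstrict, hinv, hcov'⟩ := ih _ hd' U' rfl hinv'
      obtain ⟨G, hG0, hGs⟩ : ∃ G : ℕ → Submodule ℂ (Fin m → ℂ), G 0 = U ∧ ∀ k, G (k + 1) = F k :=
        ⟨fun t => Nat.rec U (fun k _ => F k) t, rfl, fun _ => rfl⟩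
      have hGle : ∀ k, G (k + 1) ≤ U := fun k => by
        rw [hGs]; exact ((hanti (Nat.zero_le k)).trans hF0.le).trans hlt.le
      refine ⟨L + 1, G, hG0, by rw [hGs, hFL], ?_, ?_, ?_, ?_⟩
      · -- antitone
        intro a b hab
        rcases a with _ | a
        · rcases b with _ | b
          · exact le_rfl
          · rw [hG0]; exact hGle b
        · obtain ⟨b', rfl⟩ : ∃ b', b = b' + 1 := ⟨b - 1, by omega⟩
          rw [hGs, hGs]
          exact hanti (by omega)
      · -- strict steps
        intro t ht
        rcases t with _ | t
        · rw [hGs, hG0, hF0]; exact hlt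
        · rw [hGs, hGs]; exact hstrict t (by omega)
      · -- invariance
        intro t
        rcases t with _ | t
        · rw [hG0]; exact hU
        · rw [hGs]; exact hinv t
      · -- irreducible steps
        intro t ht X hX h1 h2
        rcases t with _ | t
        · rw [hGs, hF0] at h1 ⊢
          rw [hG0] at h2 ⊢
          exact hcov X hX h1 h2
        · rw [hGs] at h1 h2 ⊢
          rw [hGs]
          exact hcov' t (by omega) X hX h1 h2

/-- **COMPOSITION CHAIN.**  For any set `S` of `m × m` complex matrices there is a descending chain
`ℂ^m = F 0 > F 1 > ⋯ > F L = 0` of `S`-invariant subspaces (`A *ᵥ x ∈ F t` for `A ∈ S`, `x ∈ F t`) whose steps are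
irreducible: an `S`-invariant subspace `X` with `F (t+1) ≤ X ≤ F t` equals one of the two.  (Antitone, `ℕ`-indexed:
the input convention of ✓ `GrenetZeon.RadicalCoarsening.exists_adapted_basis`.) [folklore] -/
theorem exists_composition_chain (S : Set (Matrix (Fin m) (Fin m) ℂ)) :
    ∃ (L : ℕ) (F : ℕ → Submodule ℂ (Fin m → ℂ)), F 0 = ⊤ ∧ F L = ⊥ ∧ Antitone F ∧
      (∀ t, t < L → F (t + 1) < F t) ∧ (∀ t, ∀ A ∈ S, ∀ x ∈ F t, A *ᵥ x ∈ F t) ∧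
      (∀ t, t < L → ∀ X : Submodule ℂ (Fin m → ℂ), (∀ A ∈ S, ∀ x ∈ X, A *ᵥ x ∈ X) →
        F (t + 1) ≤ X → X ≤ F t → X = F (t + 1) ∨ X = F t) :=
  exists_composition_chain_from S _ ⊤ rfl fun _ _ _ _ => Submodule.mem_top

/-- Beyond the last step the chain is `0`; in particular `F t = ⊥` for every `t ≥ L`. [folklore] -/
theorem chain_eq_bot_of_le {L : ℕ} {F : ℕ → Submodule ℂ (Fin m → ℂ)} (hFL : F L = ⊥) (hanti : Antitone F)
    {t : ℕ} (ht : L ≤ t) : F t = ⊥ :=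
  le_bot_iff.1 (hFL ▸ hanti ht)

/-- The steps of the chain have positive dimension: `finrank (F (t+1)) < finrank (F t)` for `t < L`. [folklore] -/
theorem finrank_step_lt {L : ℕ} {F : ℕ → Submodule ℂ (Fin m → ℂ)} (hstrict : ∀ t, t < L → F (t + 1) < F t)
    {t : ℕ} (ht : t < L) : Module.finrank ℂ (F (t + 1)) < Module.finrank ℂ (F t) :=
  Submodule.finrank_lt_finrank_of_lt (hstrict t ht)

/-- The length of a composition chain is at most `m`. [folklore] -/
theorem chain_length_le {L : ℕ} {F : ℕ → Submodule ℂ (Fin m → ℂ)} (hF0 : F 0 = ⊤)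
    (hstrict : ∀ t, t < L → F (t + 1) < F t) : L ≤ m := by
  have key : ∀ t, t ≤ L → t + Module.finrank ℂ (F t) ≤ m := by
    intro t
    induction t with
    | zero =>
      intro _
      rw [hF0, finrank_top, Module.finrank_fin_fun]
      simp
    | succ t ih =>
      intro ht
      have h1 := ih (Nat.le_of_succ_le ht)
      have h2 := finrank_step_lt hstrict (Nat.lt_of_succ_le ht)
      omega
  have := key L le_rfl
  omega

end Summit.ValiantsHypothesis.ValiantsHypothesis.Theorems.GrenetZeon.HeavyTopCompositionBound

end
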